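import Mathlib
import Summits.Ventures.HodgeRepro.Tier4.Line1.RTFSetting
import Summits.Ventures.HodgeRepro.Tier4.Line1.RTFSide
import Summits.Ventures.HodgeRepro.Tier4.LitLiftBridge

/-!
# Tier4/Line1/LiftOfPeriods — LINE L1, (I4-L): the FREE lift clause `hlift` made explicit — the DEFINED period datum
of an index `m` and the PRINTED shape of «`τ m` lifts» (N. Harris / GQT / Gan–Ichino / Mínguez / Iwasawa), by name

Blind re-derivation cell `pub-hodge-repro`, Tier 4 «prove the step» (README §9–§10), seat t4-L1-p4 (gen 3; the cut of
t4-plan-1 g2, bus S13462 (7)).  Imports ONLY Mathlib, the generic RTF layer `Tier4/Line1/RTFSetting.lean`, t4-L1-p3's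
`Tier4/Line1/RTFSide.lean` (p677657: `sideWithRTFSpectrum`, `liftNonzero_withRTFSpectrum`, `P_of_rtf_inputs`,
`conclusion_of_rtf_inputs`) and t4-lit-6's `Tier4/LitLiftBridge.lean` (p659865: `Lit.liftNonzero_of_printed`, the
composition of night-2's `GQT14_Thm3`, `Lit.GanIchino2016_Thm4_4_i`, `Lit.Minguez2008_Thm1_split`,
`Lit.Iwasawa1964_Prop4_4`, `Lit.EdgeFactorization`).

WHAT THIS IS — AND IS NOT.  The costume's residual (Skeleton v0.34 `Inputs`, t4-plan-1 S13462) carries the FREE clause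
`hlift : ∀ m, PeriodNonzeroT χ (τ m) → PeriodNonzeroT′ χ′ (τ m) → Hit (cj f₁) (τ m) → Lift m` (F1 + F2 for the GIVEN
`f₁`; F2′ is why it is not universal over isolating pairs).  This module PROVES NOTHING of F1 + F2.  It does two
bookkeeping things, each by name:

* `RTF.Setting.PeriodData χ χ′ τ f₁ m` — the DEFINED statement «`τ m` carries both toric functionals and is hit by
  `f̄₁`» as ONE `Prop` structure (three clauses, the output of `exists_periods_of_isolation`: `exists_periodData_of_isolation`);
  `forall_periodData_iff` rewrites `hlift` as `∀ m, PeriodData … m → Lift m`.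
* `hlift_of_printed` — on the RTF-instantiated face `(sideWithRTFSpectrum E₀ S χ χ′ τ tl Lift).toC7Face` (whose
  `Tau = ℕ` and whose `liftNonzero m` IS `Lift m`, `liftNonzero_withRTFSpectrum`), the clause `hlift` FOLLOWS from
  the five printed statements typed by t4-lit-6 / night-2 on that face — `GQT14_Thm3` (the local–global criterion,
  GQT 2014 Thm 3), `GanIchino2016_Thm4_4_i`, `Minguez2008_Thm1_split`, `Iwasawa1964_Prop4_4`, `EdgeFactorization`
  (N. Harris IMRN 2014 Thm 5.15's edge value `L_E(1, BC(π) ⊗ γ³)` through Iwasawa) — together with the three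
  `τ`-level clauses a line must still supply, here asked ONLY for the indices `m` with `PeriodData`: the parameter
  dodged at the non-split finite places (`hdodge`), non-zero archimedean lifts (`harch`), the `(2,0)` `K`-type
  (`hhol`).  So the displayed `hlift` of `P_of_rtf_inputs` / `conclusion_of_rtf_inputs` is replaced by
  `(J, T, H, hG, hGI, hMi, h44, hfac, hdodge, harch, hhol)` in `P_of_rtf_inputs_printed` /
  `conclusion_of_rtf_inputs_printed` — the printed shape of the lift residual, exactly (INPUTS.md rows by name).

Every hypothesis of the printed statements is DISPLAYED (they are `def … : Prop` of the Literature modules, never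
proved here); the interfaces `J`, `T`, `H` are DATA of the residual, not constructed.  Nothing here says anything
about the status of the Hodge conjecture for CM abelian varieties, which is NOT proved (HC_CM is NOT proved by
anyone in this repository).
-/

set_option autoImplicit false

noncomputable section

namespace Summit.Ventures.HodgeRepro.Tier4.Line1

open NumberField Common PeriodCloser MeasureTheory

namespace RTF.Setting

variable {G : Type} [Group G] [TopologicalSpace G] [MeasurableSpace G] (S : RTF.Setting G)

/-- **The DEFINED period datum of an index `m`**: `τ m` carries the `χ`-toric functional, the `χ′`-toric functional,
and is hit by `f̄₁` (the three clauses of `exists_periods_of_isolation`'s conclusion, L1.5 `atoms`). -/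
structure PeriodData (χ : S.T → ℂ) (χ' : S.T' → ℂ) (τ : ℕ → Set (G → ℂ)) (f₁ : G → ℂ) (m : ℕ) : Prop where
  /-- the `χ`-toric functional is non-zero on `τ m` -/
  periodT : S.PeriodNonzeroT χ (τ m)
  /-- the `χ′`-toric functional is non-zero on `τ m` -/
  periodT' : S.PeriodNonzeroT' χ' (τ m)
  /-- `τ m` is hit by `f̄₁` (`R(f̄₁)` not identically zero on `τ m`) -/
  hit : S.Hit (RTF.cj f₁) (τ m)

/-- The lift clause `hlift` of the costume, rewritten through `PeriodData`. -/
theorem forall_periodData_iff {χ : S.T → ℂ} {χ' : S.T' → ℂ} {τ : ℕ → Set (G → ℂ)} {f₁ : G → ℂ}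
    (Lift : ℕ → Prop) :
    (∀ m, S.PeriodData χ χ' τ f₁ m → Lift m) ↔
      ∀ m, S.PeriodNonzeroT χ (τ m) → S.PeriodNonzeroT' χ' (τ m) → S.Hit (RTF.cj f₁) (τ m) → Lift m :=
  ⟨fun h m hT hT' hhit => h m ⟨hT, hT', hhit⟩, fun h m hm => h m hm.periodT hm.periodT' hm.hit⟩

/-- **The RTF output as a period datum**: the DEFINED content (characters, adapted family, an isolating pair with a
non-zero orbital term) produces an index `m` with `PeriodData` — `exists_periods_of_isolation` repackaged. -/
theorem exists_periodData_of_isolation [IsTopologicalGroup G] [BorelSpace G] {χ : S.T → ℂ} {χ' : S.T' → ℂ}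
    (hχ : S.IsCharacter χ) (hχ' : S.IsCharacter' χ') {τ : ℕ → Set (G → ℂ)} {φ : ℕ → G → ℂ} {n : ℕ → ℕ}
    (hB : S.IsAdaptedONB τ φ n) {f₁ f₂ : G → ℂ} (h₁ : RTF.IsTest f₁) (h₂ : RTF.IsTest f₂)
    (hconv : RTF.IsTest (S.conv f₁ f₂)) {o₀ : S.Orbit} (hiso : S.geoSupport (S.conv f₁ f₂) = {o₀})
    (hne : S.orbital χ χ' o₀ (S.conv f₁ f₂) ≠ 0) : ∃ m, S.PeriodData χ χ' τ f₁ m := by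
  obtain ⟨m, hT, hT', hhit⟩ := S.exists_periods_of_isolation hχ hχ' hB h₁ h₂ hconv hiso hne
  exact ⟨m, hT, hT', hhit⟩

end RTF.Setting

section Printed

variable {L : Type} [Field L] [NumberField L] [IsCMField L]
  {Form : Type} [AddCommGroup Form] [Module ℂ Form] {A : FormAlgebra Form} {W : Witness A}
  {Θ : ThetaLifts W} (E₀ : EndoscopicSide L W Θ)
  {G : Type} [Group G] [TopologicalSpace G] [MeasurableSpace G]
  (S : RTF.Setting G) (χ : S.T → ℂ) (χ' : S.T' → ℂ) (τ : ℕ → Set (G → ℂ)) (tl : Θ.U1Char → ℕ) (Lift : ℕ → Prop)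
  (f₁ : G → ℂ)

/-- **`hlift` from the printed composition** on the RTF-instantiated face: the lift interfaces `J`, `T`, `H` of
t4-lit-6 / night-2 on `(sideWithRTFSpectrum E₀ S χ χ′ τ tl Lift).toC7Face` (where `liftNonzero m` IS `Lift m`),
the five printed statements as DISPLAYED hypotheses, and the three `τ`-level clauses for the indices with
`PeriodData` (parameter dodged at the non-split finite places, non-zero archimedean lifts, the `(2,0)` `K`-type)
give the costume's `hlift` — `Lit.liftNonzero_of_printed` index by index. -/
theorem hlift_of_printed
    (J : LiftInterface (sideWithRTFSpectrum E₀ S χ χ' τ tl Lift).toC7Face)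
    (T : Lit.LocalThetaInterface (sideWithRTFSpectrum E₀ S χ χ' τ tl Lift).toC7Face J)
    (H : Lit.HeckeLInterface (sideWithRTFSpectrum E₀ S χ χ' τ tl Lift).toC7Face)
    (hG : GQT14_Thm3 (sideWithRTFSpectrum E₀ S χ χ' τ tl Lift).toC7Face J)
    (hGI : Lit.GanIchino2016_Thm4_4_i (sideWithRTFSpectrum E₀ S χ χ' τ tl Lift).toC7Face J T)
    (hMi : Lit.Minguez2008_Thm1_split (sideWithRTFSpectrum E₀ S χ χ' τ tl Lift).toC7Face J T)
    (h44 : Lit.Iwasawa1964_Prop4_4 (sideWithRTFSpectrum E₀ S χ χ' τ tl Lift).toC7Face H)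
    (hfac : Lit.EdgeFactorization (sideWithRTFSpectrum E₀ S χ χ' τ tl Lift).toC7Face J H)
    (hdodge : ∀ m, S.PeriodData χ χ' τ f₁ m →
      ∀ v : (sideWithRTFSpectrum E₀ S χ χ' τ tl Lift).toC7Face.Place, ¬ T.IsArch v →
        ¬ (sideWithRTFSpectrum E₀ S χ χ' τ tl Lift).toC7Face.IsSplit v → ¬ T.ParamContainsChiV v m)
    (harch : ∀ m, S.PeriodData χ χ' τ f₁ m →
      ∀ v : (sideWithRTFSpectrum E₀ S χ χ' τ tl Lift).toC7Face.Place, T.IsArch v → J.localLiftNonzero v m)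
    (hhol : ∀ m, S.PeriodData χ χ' τ f₁ m → J.holomorphicType m) :
    ∀ m, S.PeriodNonzeroT χ (τ m) → S.PeriodNonzeroT' χ' (τ m) → S.Hit (RTF.cj f₁) (τ m) → Lift m := by
  intro m hT hT' hhit
  have hm : S.PeriodData χ χ' τ f₁ m := ⟨hT, hT', hhit⟩
  exact (liftNonzero_withRTFSpectrum E₀ S χ χ' τ tl Lift m).mp
    (Lit.liftNonzero_of_printed _ J T H hG hGI hMi h44 hfac m (hdodge m hm) (harch m hm) (hhol m hm))

/-- **(P) for the witness with the lift residual in its PRINTED shape**: `P_of_rtf_inputs` with `hlift` replaced by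
the interfaces, the five printed statements and the three `τ`-level clauses on the period-carrying indices. -/
theorem P_of_rtf_inputs_printed [IsTopologicalGroup G] [BorelSpace G] (hχ : S.IsCharacter χ)
    (hχ' : S.IsCharacter' χ') {φ : ℕ → G → ℂ} {n : ℕ → ℕ} (hB : S.IsAdaptedONB τ φ n) {f₂ : G → ℂ}
    (h₁ : RTF.IsTest f₁) (h₂ : RTF.IsTest f₂) (hconv : RTF.IsTest (S.conv f₁ f₂)) {o₀ : S.Orbit}
    (hiso : S.geoSupport (S.conv f₁ f₂) = {o₀}) (hne : S.orbital χ χ' o₀ (S.conv f₁ f₂) ≠ 0)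
    (base : W.Translates)
    (J : LiftInterface (sideWithRTFSpectrum E₀ S χ χ' τ tl Lift).toC7Face)
    (T : Lit.LocalThetaInterface (sideWithRTFSpectrum E₀ S χ χ' τ tl Lift).toC7Face J)
    (H : Lit.HeckeLInterface (sideWithRTFSpectrum E₀ S χ χ' τ tl Lift).toC7Face)
    (hG : GQT14_Thm3 (sideWithRTFSpectrum E₀ S χ χ' τ tl Lift).toC7Face J)
    (hGI : Lit.GanIchino2016_Thm4_4_i (sideWithRTFSpectrum E₀ S χ χ' τ tl Lift).toC7Face J T)
    (hMi : Lit.Minguez2008_Thm1_split (sideWithRTFSpectrum E₀ S χ χ' τ tl Lift).toC7Face J T)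
    (h44 : Lit.Iwasawa1964_Prop4_4 (sideWithRTFSpectrum E₀ S χ χ' τ tl Lift).toC7Face H)
    (hfac : Lit.EdgeFactorization (sideWithRTFSpectrum E₀ S χ χ' τ tl Lift).toC7Face J H)
    (hdodge : ∀ m, S.PeriodData χ χ' τ f₁ m →
      ∀ v : (sideWithRTFSpectrum E₀ S χ χ' τ tl Lift).toC7Face.Place, ¬ T.IsArch v →
        ¬ (sideWithRTFSpectrum E₀ S χ χ' τ tl Lift).toC7Face.IsSplit v → ¬ T.ParamContainsChiV v m)
    (harch : ∀ m, S.PeriodData χ χ' τ f₁ m →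
      ∀ v : (sideWithRTFSpectrum E₀ S χ χ' τ tl Lift).toC7Face.Place, T.IsArch v → J.localLiftNonzero v m)
    (hhol : ∀ m, S.PeriodData χ χ' τ f₁ m → J.holomorphicType m)
    (hseesaw : ∃ Sp : SpectralInterface (sideWithRTFSpectrum E₀ S χ χ' τ tl Lift).toC7Face,
      SeesawComponents (sideWithRTFSpectrum E₀ S χ χ' τ tl Lift).toC7Face Sp) : W.P :=
  P_of_rtf_inputs E₀ S χ χ' τ tl Lift hχ hχ' hB h₁ h₂ hconv hiso hne base
    (hlift_of_printed E₀ S χ χ' τ tl Lift f₁ J T H hG hGI hMi h44 hfac hdodge harch hhol) hseesaw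

end Printed

section Target

variable {F E : Type} [Field F] [NumberField F] [IsGalois ℚ F] [IsCMField F]
  [Field E] [NumberField E] [IsGalois ℚ E] [IsCMField E]

/-- **The conclusion of `P_T4` for a datum `d` with the lift residual in its PRINTED shape**:
`conclusion_of_rtf_inputs` with `hlift` replaced by the lift interfaces on the RTF-instantiated face, the five
printed statements and the three `τ`-level clauses on the period-carrying indices. -/
theorem conclusion_of_rtf_inputs_printed (d : TargetData F E) {Γ' : Set (Matrix (Fin 3) (Fin 3) E)}
    (hΓ' : d.IsLevel Γ') (hcc : d.IsCocompact Γ')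
    {Θ : ThetaLifts (d.concreteWitness hΓ' (isDomain_dom d hΓ').subset_ball (isDomain_dom d hΓ').measurableSet
      (d.residual_of_cocompact hΓ' hcc))}
    (E₀ : EndoscopicSide E (d.concreteWitness hΓ' (isDomain_dom d hΓ').subset_ball
      (isDomain_dom d hΓ').measurableSet (d.residual_of_cocompact hΓ' hcc)) Θ)
    {G : Type} [Group G] [TopologicalSpace G] [IsTopologicalGroup G] [MeasurableSpace G] [BorelSpace G]
    (S : RTF.Setting G) {χ : S.T → ℂ} {χ' : S.T' → ℂ} (hχ : S.IsCharacter χ) (hχ' : S.IsCharacter' χ')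
    {τ : ℕ → Set (G → ℂ)} {φ : ℕ → G → ℂ} {n : ℕ → ℕ} (hB : S.IsAdaptedONB τ φ n) {f₁ f₂ : G → ℂ}
    (h₁ : RTF.IsTest f₁) (h₂ : RTF.IsTest f₂) (hconv : RTF.IsTest (S.conv f₁ f₂)) {o₀ : S.Orbit}
    (hiso : S.geoSupport (S.conv f₁ f₂) = {o₀}) (hne : S.orbital χ χ' o₀ (S.conv f₁ f₂) ≠ 0)
    (tl : Θ.U1Char → ℕ) (Lift : ℕ → Prop)
    (base : (d.concreteWitness hΓ' (isDomain_dom d hΓ').subset_ball (isDomain_dom d hΓ').measurableSet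
      (d.residual_of_cocompact hΓ' hcc)).Translates)
    (J : LiftInterface (sideWithRTFSpectrum E₀ S χ χ' τ tl Lift).toC7Face)
    (T : Lit.LocalThetaInterface (sideWithRTFSpectrum E₀ S χ χ' τ tl Lift).toC7Face J)
    (H : Lit.HeckeLInterface (sideWithRTFSpectrum E₀ S χ χ' τ tl Lift).toC7Face)
    (hG : GQT14_Thm3 (sideWithRTFSpectrum E₀ S χ χ' τ tl Lift).toC7Face J)
    (hGI : Lit.GanIchino2016_Thm4_4_i (sideWithRTFSpectrum E₀ S χ χ' τ tl Lift).toC7Face J T)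
    (hMi : Lit.Minguez2008_Thm1_split (sideWithRTFSpectrum E₀ S χ χ' τ tl Lift).toC7Face J T)
    (h44 : Lit.Iwasawa1964_Prop4_4 (sideWithRTFSpectrum E₀ S χ χ' τ tl Lift).toC7Face H)
    (hfac : Lit.EdgeFactorization (sideWithRTFSpectrum E₀ S χ χ' τ tl Lift).toC7Face J H)
    (hdodge : ∀ m, S.PeriodData χ χ' τ f₁ m →
      ∀ v : (sideWithRTFSpectrum E₀ S χ χ' τ tl Lift).toC7Face.Place, ¬ T.IsArch v →
        ¬ (sideWithRTFSpectrum E₀ S χ χ' τ tl Lift).toC7Face.IsSplit v → ¬ T.ParamContainsChiV v m)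
    (harch : ∀ m, S.PeriodData χ χ' τ f₁ m →
      ∀ v : (sideWithRTFSpectrum E₀ S χ χ' τ tl Lift).toC7Face.Place, T.IsArch v → J.localLiftNonzero v m)
    (hhol : ∀ m, S.PeriodData χ χ' τ f₁ m → J.holomorphicType m)
    (hseesaw : ∃ Sp : SpectralInterface (sideWithRTFSpectrum E₀ S χ χ' τ tl Lift).toC7Face,
      SeesawComponents (sideWithRTFSpectrum E₀ S χ χ' τ tl Lift).toC7Face Sp) : d.conclusion :=
  conclusion_of_rtf_inputs d hΓ' hcc E₀ S hχ hχ' hB h₁ h₂ hconv hiso hne tl Lift base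
    (hlift_of_printed E₀ S χ χ' τ tl Lift f₁ J T H hG hGI hMi h44 hfac hdodge harch hhol) hseesaw

end Target

end Summit.Ventures.HodgeRepro.Tier4.Line1

end
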